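import Literature.NumberTheory.LFunctions.SoundTestFunction
import Literature.Analysis.Complex.LittlewoodLemma
import HarnessLib

/-!
# The `u`-integrals of the zero terms `Ψ(w − (u+it))` (Balazard–de Roton Prop. 5, zero side)

Topic `Literature/NumberTheory/LFunctions`. Everything here is PROVED. For a point `w` (a zero
`ρ` or its reflection `1 − ρ`) with `Re w < σ`, the height `t`, the points `s = σ + it`,
`s' = 2 + it`, `z_u = u + it` and `L = log x > 0` we compute and bound

  `∫_σ^2 Re Ψ_L(w − z_u) du`,   `Ψ_L(a) = e^{aL}/a² − 1/a² − L/a` (`SoundTest.psiInt_eq`):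

* `SoundTest.integral_inv_sq_sub_line` — `∫_σ^2 du/(w − z_u)² = 1/(w − s') − 1/(w − s)`;
* `SoundTest.integral_re_inv_sub_line` — `∫_σ^2 Re (1/(w − z_u)) du = log‖s − w‖ − log‖s' − w‖`;
* `SoundTest.norm_integral_exp_div_sq_le` — for `Re w = ½`:
  `‖∫_σ^2 e^{(w − z_u)L}/(w − z_u)² du‖ ≤ x^{½−σ}/(L‖s − w‖²)` (`x = e^L`);
* `SoundTest.integral_re_psiInt_sub_line` — the resulting formula
  `∫_σ^2 Re Ψ(w − z_u) du = E + Re 1/(s'−w) − Re 1/(s−w) + L (log‖s'−w‖ − log‖s−w‖)`,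
  `|E| ≤ x^{½−σ}/(L‖s−w‖²)`.

This is the integration "entre `z = σ + it` et `z = 2 + it`" of M. Balazard, A. de Roton,
arXiv:0810.3587, proof of Prop. 5, performed on the zero side of the Weil explicit formula.

## References

* [BalazardDeRoton2008] M. Balazard, A. de Roton, arXiv:0810.3587, Prop. 5. [cite: BalazardDeRoton2008, Prop. 5 (proof)]
-/

noncomputable section

open Complex Filter Set MeasureTheory Topology intervalIntegral
open scoped Real

namespace Literature.NumberTheory.LFunctions

namespace SoundTest

section ZeroTerm

variable {w : ℂ} {σ t L : ℝ}

/-- The points of the segment: `w − (u + it) ≠ 0` when `Re w < σ ≤ u`. [folklore] -/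
theorem sub_line_ne_zero (hw : w.re < σ) {u : ℝ} (hu : σ ≤ u) : w - ((u : ℂ) + t * I) ≠ 0 := by
  intro h
  have := congrArg Complex.re h
  simp at this
  linarith

/-- `‖w − (u+it)‖ ≥ ‖w − (σ+it)‖` for `u ≥ σ > Re w`. [folklore] -/
theorem norm_sub_line_ge (hw : w.re < σ) {u : ℝ} (hu : σ ≤ u) :
    ‖w - ((σ : ℂ) + t * I)‖ ≤ ‖w - ((u : ℂ) + t * I)‖ := by
  rw [← Real.sqrt_sq (norm_nonneg _), ← Real.sqrt_sq (norm_nonneg (w - ((u : ℂ) + t * I))),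
    Complex.sq_norm, Complex.sq_norm, Complex.normSq_apply, Complex.normSq_apply]
  refine Real.sqrt_le_sqrt ?_
  simp only [Complex.sub_re, Complex.add_re, Complex.ofReal_re, Complex.mul_re, Complex.I_re,
    mul_zero, Complex.ofReal_im, Complex.I_im, mul_one, sub_self, add_zero, Complex.sub_im,
    Complex.add_im, Complex.mul_im, zero_add]
  nlinarith

/-- **`∫_σ^2 du/(w − z_u)² = 1/(w − s') − 1/(w − s)`** (`Re w < σ ≤ 2`). [folklore] -/
theorem integral_inv_sq_sub_line (hw : w.re < σ) (hσ : σ ≤ 2) :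
    ∫ u in σ..2, 1 / (w - ((u : ℂ) + t * I)) ^ 2 =
      1 / (w - ((2 : ℂ) + t * I)) - 1 / (w - ((σ : ℂ) + t * I)) := by
  have hderiv : ∀ u ∈ Set.uIcc σ 2, HasDerivAt (fun u : ℝ ↦ 1 / (w - ((u : ℂ) + t * I)))
      (1 / (w - ((u : ℂ) + t * I)) ^ 2) u := by
    intro u hu
    rw [Set.uIcc_of_le hσ] at hu
    have hne := sub_line_ne_zero (t := t) hw hu.1
    have h1 : HasDerivAt (fun u : ℝ ↦ w - ((u : ℂ) + t * I)) (-1) u := by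
      have h := ((hasDerivAt_id (u : ℂ)).add_const ((t : ℂ) * I)).const_sub w
      simpa using h.comp_ofReal
    have h2 := h1.inv hne
    have e : (fun u : ℝ ↦ 1 / (w - ((u : ℂ) + t * I))) = fun u : ℝ ↦ (w - ((u : ℂ) + t * I))⁻¹ := by
      funext u; rw [one_div]
    rw [e]
    refine h2.congr_deriv ?_
    rw [neg_neg]
  have hcont : ContinuousOn (fun u : ℝ ↦ 1 / (w - ((u : ℂ) + t * I)) ^ 2) (Set.uIcc σ 2) := by
    refine ContinuousOn.div continuousOn_const (by fun_prop) fun u hu ↦ ?_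
    rw [Set.uIcc_of_le hσ] at hu
    exact pow_ne_zero 2 (sub_line_ne_zero (t := t) hw hu.1)
  rw [intervalIntegral.integral_eq_sub_of_hasDerivAt hderiv (hcont.intervalIntegrable)]
  push_cast
  ring_nf

/-- **`∫_σ^2 Re(1/(w − z_u)) du = log‖s − w‖ − log‖s' − w‖`** (`Re w < σ ≤ 2`). [folklore] -/
theorem integral_re_inv_sub_line (hw : w.re < σ) (hσ : σ ≤ 2) :
    ∫ u in σ..2, (1 / (w - ((u : ℂ) + t * I))).re =
      Real.log ‖((σ : ℂ) + t * I) - w‖ - Real.log ‖((2 : ℂ) + t * I) - w‖ := by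
  -- `g(z) = w − z`, `g'/g = −1/(w − z)`
  have hg : ∀ u ∈ Icc σ 2, AnalyticAt ℂ (fun z : ℂ ↦ w - z) ((u : ℂ) + t * I) := fun u _ ↦ by fun_prop
  have h0 : ∀ u ∈ Icc σ 2, (fun z : ℂ ↦ w - z) ((u : ℂ) + t * I) ≠ 0 := fun u hu ↦
    sub_line_ne_zero (t := t) hw hu.1
  have h := Literature.Analysis.Complex.re_integral_logDeriv_horizontal t hσ hg h0
  have hd : ∀ z : ℂ, deriv (fun z : ℂ ↦ w - z) z = -1 := fun z ↦ by
    rw [deriv_const_sub, deriv_id'']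
  simp only [hd] at h
  have hint : IntervalIntegrable (fun u : ℝ ↦ 1 / (w - ((u : ℂ) + t * I))) volume σ 2 := by
    refine ContinuousOn.intervalIntegrable (ContinuousOn.div continuousOn_const (by fun_prop) fun u hu ↦ ?_)
    rw [Set.uIcc_of_le hσ] at hu
    exact sub_line_ne_zero (t := t) hw hu.1
  have hre := intervalIntegral_re hint
  simp only [RCLike.re_to_complex] at hre
  rw [hre]
  have e1 : (∫ u in σ..2, (1 : ℂ) / (w - ((u : ℂ) + t * I))) = -∫ u in σ..2, (-1 : ℂ) / (w - ((u : ℂ) + t * I)) := by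
    rw [← intervalIntegral.integral_neg]
    congr 1; funext u; ring
  rw [e1, Complex.neg_re, h, norm_sub_rev w, norm_sub_rev w]
  push_cast
  ring

/-- `∫_σ^2 x^{½−u} du ≤ x^{½−σ}/L` (`x = e^L`, `L > 0`). [folklore] -/
theorem integral_exp_half_sub_le (hL : 0 < L) :
    ∫ u in σ..2, Real.exp ((1 / 2 - u) * L) ≤ Real.exp ((1 / 2 - σ) * L) / L := by
  have hderiv : ∀ u ∈ Set.uIcc σ 2, HasDerivAt (fun u : ℝ ↦ -Real.exp ((1 / 2 - u) * L) / L)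
      (Real.exp ((1 / 2 - u) * L)) u := by
    intro u _
    have hL0 : L ≠ 0 := hL.ne'
    have h1 : HasDerivAt (fun u : ℝ ↦ (1 / 2 - u) * L) (-L) u := by
      simpa using ((hasDerivAt_id u).const_sub (1 / 2 : ℝ)).mul_const L
    have h2 := h1.exp
    refine (h2.neg.div_const L).congr_deriv ?_
    rw [mul_neg, neg_neg, mul_div_cancel_right₀ _ hL0]
  rw [intervalIntegral.integral_eq_sub_of_hasDerivAt hderiv (by
    exact (Continuous.intervalIntegrable (by fun_prop) _ _))]
  have h0 : 0 ≤ Real.exp ((1 / 2 - 2) * L) / L := by positivity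
  rw [neg_div, neg_div]
  linarith

/-- **The `x`-term**: for `Re w = ½`, `σ > ½`,
`‖∫_σ^2 e^{(w−z_u)L}/(w−z_u)² du‖ ≤ x^{½−σ}/(L ‖s − w‖²)`. [cite: BalazardDeRoton2008, Prop. 5 (proof)] -/
theorem norm_integral_exp_div_sq_le (hw : w.re = 1 / 2) (hσ1 : 1 / 2 < σ) (hσ : σ ≤ 2) (hL : 0 < L) :
    ‖∫ u in σ..2, Complex.exp ((w - ((u : ℂ) + t * I)) * L) / (w - ((u : ℂ) + t * I)) ^ 2‖ ≤
      Real.exp ((1 / 2 - σ) * L) / (L * ‖((σ : ℂ) + t * I) - w‖ ^ 2) := by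
  have hw' : w.re < σ := by rw [hw]; exact hσ1
  have hs0 : 0 < ‖((σ : ℂ) + t * I) - w‖ := by
    rw [norm_sub_rev]; exact norm_pos_iff.2 (sub_line_ne_zero (t := t) hw' le_rfl)
  -- pointwise bound by `x^{½−u}/‖s−w‖²`
  have hbound : ∀ u ∈ Set.Ioc σ 2, ‖Complex.exp ((w - ((u : ℂ) + t * I)) * L) / (w - ((u : ℂ) + t * I)) ^ 2‖ ≤
      Real.exp ((1 / 2 - u) * L) / ‖((σ : ℂ) + t * I) - w‖ ^ 2 := by
    intro u hu
    rw [norm_div, norm_pow, Complex.norm_exp]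
    have hre : ((w - ((u : ℂ) + t * I)) * (L : ℂ)).re = (1 / 2 - u) * L := by
      simp [hw]
    rw [hre]
    refine div_le_div_of_nonneg_left (Real.exp_pos _).le (pow_pos hs0 2) ?_
    refine pow_le_pow_left₀ (norm_nonneg _) ?_ 2
    rw [norm_sub_rev ((σ : ℂ) + t * I) w]; exact norm_sub_line_ge hw' hu.1.le
  calc ‖∫ u in σ..2, Complex.exp ((w - ((u : ℂ) + t * I)) * L) / (w - ((u : ℂ) + t * I)) ^ 2‖
      ≤ ∫ u in σ..2, Real.exp ((1 / 2 - u) * L) / ‖((σ : ℂ) + t * I) - w‖ ^ 2 := by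
        refine intervalIntegral.norm_integral_le_of_norm_le hσ (Eventually.of_forall hbound) ?_
        exact (Continuous.intervalIntegrable (by fun_prop) _ _)
    _ = (∫ u in σ..2, Real.exp ((1 / 2 - u) * L)) / ‖((σ : ℂ) + t * I) - w‖ ^ 2 := by
        rw [intervalIntegral.integral_div]
    _ ≤ (Real.exp ((1 / 2 - σ) * L) / L) / ‖((σ : ℂ) + t * I) - w‖ ^ 2 := by
        gcongr; exact integral_exp_half_sub_le hL
    _ = Real.exp ((1 / 2 - σ) * L) / (L * ‖((σ : ℂ) + t * I) - w‖ ^ 2) := by rw [div_div]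

/-- **The `u`-integral of one zero term.** For `Re w = ½ < σ ≤ 2`, `L > 0`:
`∫_σ^2 Re Ψ_L(w − z_u) du = E + Re 1/(s'−w) − Re 1/(s−w) + L (log‖s'−w‖ − log‖s−w‖)` with
`|E| ≤ x^{½−σ}/(L‖s−w‖²)` (`s = σ+it`, `s' = 2+it`, `x = e^L`). [cite: BalazardDeRoton2008, Prop. 5 (proof)] -/
theorem integral_re_psiInt_sub_line (hw : w.re = 1 / 2) (hσ1 : 1 / 2 < σ) (hσ : σ ≤ 2) (hL : 0 < L) :
    ∃ E : ℝ, |E| ≤ Real.exp ((1 / 2 - σ) * L) / (L * ‖((σ : ℂ) + t * I) - w‖ ^ 2) ∧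
      ∫ u in σ..2, (psiInt L (w - ((u : ℂ) + t * I))).re =
        E + ((1 / (((2 : ℂ) + t * I) - w)).re - (1 / (((σ : ℂ) + t * I) - w)).re) +
          L * (Real.log ‖((2 : ℂ) + t * I) - w‖ - Real.log ‖((σ : ℂ) + t * I) - w‖) := by
  have hw' : w.re < σ := by rw [hw]; exact hσ1
  set X : ℝ → ℂ := fun u ↦ Complex.exp ((w - ((u : ℂ) + t * I)) * L) / (w - ((u : ℂ) + t * I)) ^ 2 with hX
  set Y : ℝ → ℂ := fun u ↦ 1 / (w - ((u : ℂ) + t * I)) ^ 2 with hY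
  set W : ℝ → ℂ := fun u ↦ 1 / (w - ((u : ℂ) + t * I)) with hW
  refine ⟨(∫ u in σ..2, X u).re, ?_, ?_⟩
  · exact (Complex.abs_re_le_norm _).trans (norm_integral_exp_div_sq_le hw hσ1 hσ hL)
  -- `Re Ψ(w − z_u) = Re X − Re Y − L Re W` on `[σ, 2]`
  have hne : ∀ u ∈ Set.uIcc σ 2, w - ((u : ℂ) + t * I) ≠ 0 := fun u hu ↦ by
    rw [Set.uIcc_of_le hσ] at hu; exact sub_line_ne_zero (t := t) hw' hu.1
  have hcongr : ∀ u ∈ Set.uIcc σ 2, (psiInt L (w - ((u : ℂ) + t * I))).re =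
      (X u).re - (Y u).re - L * (W u).re := by
    intro u hu
    rw [psiInt_eq (hne u hu)]
    simp only [hX, hY, hW]
    have e : (Complex.exp ((w - ((u : ℂ) + t * I)) * L) - 1 - (w - ((u : ℂ) + t * I)) * L) /
        (w - ((u : ℂ) + t * I)) ^ 2 =
        Complex.exp ((w - ((u : ℂ) + t * I)) * L) / (w - ((u : ℂ) + t * I)) ^ 2 -
          1 / (w - ((u : ℂ) + t * I)) ^ 2 - (L : ℂ) * (1 / (w - ((u : ℂ) + t * I))) := by
      field_simp [hne u hu]
    rw [e, Complex.sub_re, Complex.sub_re, Complex.re_ofReal_mul]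
  rw [intervalIntegral.integral_congr hcongr]
  -- continuity of the pieces
  have hcW : ContinuousOn W (Set.uIcc σ 2) :=
    ContinuousOn.div continuousOn_const (by fun_prop) hne
  have hcY : ContinuousOn Y (Set.uIcc σ 2) :=
    ContinuousOn.div continuousOn_const (by fun_prop) fun u hu ↦ pow_ne_zero 2 (hne u hu)
  have hcX : ContinuousOn X (Set.uIcc σ 2) :=
    ContinuousOn.div (by fun_prop) (by fun_prop) fun u hu ↦ pow_ne_zero 2 (hne u hu)
  have hiX : IntervalIntegrable (fun u ↦ (X u).re) volume σ 2 :=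
    (Complex.continuous_re.comp_continuousOn hcX).intervalIntegrable
  have hiY : IntervalIntegrable (fun u ↦ (Y u).re) volume σ 2 :=
    (Complex.continuous_re.comp_continuousOn hcY).intervalIntegrable
  have hiW : IntervalIntegrable (fun u ↦ L * (W u).re) volume σ 2 :=
    ((Complex.continuous_re.comp_continuousOn hcW).intervalIntegrable).const_mul L
  rw [intervalIntegral.integral_sub (hiX.sub hiY) hiW, intervalIntegral.integral_sub hiX hiY,
    intervalIntegral.integral_const_mul (μ := volume) (a := σ) (b := 2) L (fun u ↦ (W u).re)]
  -- evaluate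
  have hXre : (∫ u in σ..2, (X u).re) = (∫ u in σ..2, X u).re := by
    have := intervalIntegral_re (hcX.intervalIntegrable (μ := volume))
    simpa only [RCLike.re_to_complex] using this
  have hYre : (∫ u in σ..2, (Y u).re) = (1 / (w - ((2 : ℂ) + t * I)) - 1 / (w - ((σ : ℂ) + t * I))).re := by
    have := intervalIntegral_re (hcY.intervalIntegrable (μ := volume))
    simp only [RCLike.re_to_complex] at this
    rw [this, hY]
    exact congrArg Complex.re (integral_inv_sq_sub_line hw' hσ)
  have hWre : (∫ u in σ..2, (W u).re) = Real.log ‖((σ : ℂ) + t * I) - w‖ - Real.log ‖((2 : ℂ) + t * I) - w‖ :=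
    integral_re_inv_sub_line hw' hσ
  rw [hXre, hYre, hWre]
  -- `Re 1/(w − s') = −Re 1/(s' − w)` etc.
  have e1 : (1 / (w - ((2 : ℂ) + t * I))).re = -(1 / (((2 : ℂ) + t * I) - w)).re := by
    rw [← neg_sub ((2 : ℂ) + t * I) w, div_neg_eq_neg_div, Complex.neg_re]
  have e2 : (1 / (w - ((σ : ℂ) + t * I))).re = -(1 / (((σ : ℂ) + t * I) - w)).re := by
    rw [← neg_sub ((σ : ℂ) + t * I) w, div_neg_eq_neg_div, Complex.neg_re]
  rw [Complex.sub_re, e1, e2]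
  ring

end ZeroTerm

end SoundTest

end Literature.NumberTheory.LFunctions
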